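import Summits.AtomisticToContinuum.Crystallization.Theses.ThreeConeCertificate
import Summits.AtomisticToContinuum.Crystallization.Theorems.ExactCertificate.Negative.SplitBasics
import Summits.AtomisticToContinuum.Crystallization.Theorems.ThreeConeCertificateExactCertificateSlacknessEnergy
import Summits.AtomisticToContinuum.Crystallization.Theorems.ThreeConeCertificateExactCertificateNoGapNecessary

/-!
# Crux `ExactCertificate` (stmt-AtomisticToContinuum-11959) — line `Ideator4Sketch` (CHARGE BLOW-UP),
# skeleton v1 OWNED by line lead a2 (2026-08-16)

Origin: crux-ideate round 2, ideator 4 (card `Ideas/charge-blowup.md`, sketch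
`Cruxes/ExactCertificate/Ideator4Sketch.lean`, numerics `CHARGE-BLOWUP-numerics.md`).  The sketch is kept
verbatim below (it is sorry-free): the tail system of a witness `(P, ρ, c, g, U, f)` and its finite
sections, the CHARGE CEILING `f 0 ≤ −2 e(P)` (from `c ≥ 0` and (S6) alone — no `e*`, no stability
constant), the COMPLETENESS of finite sections (pointwise ultralimit), and the shape of a FINITE dual
(Schoenberg) kill certificate (modulo the named hypothesis `SchoenbergTransfer`).

WHAT THE LEAD ADDS (section "The line, owned" at the end).  The sketch has no `ExactCertificate_of`: it is
a negation / decidability lane, and it composes to the crux only in the NEGATIVE direction.  The owned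
skeleton makes that composition explicit and sorry-free —
`not_exactCertificate_of : stub_tailEmpty → ¬ ExactCertificate` — through the proved reduction
`exists_minimiser_exactWith_of_exactCertificate` (a crux witness hands the lane a template `P` that is a
PERIODIC MINIMISER of `e_LJ`, tree `Slackness.periodicMinimum_of_witness`, together with a witness at
every integer range beyond its own, `IsSplit.mono`) and L1 (`tailSection_of_exactWith`).  The single
load-bearing stub, registered with every notion unfolded to tree vocabulary, is

* `stub_tailEmpty` — for every periodic minimiser `P` of the Lennard-Jones energy per particle and every
  integer range `n`, the full tail section of `P` at range `n` with the template's own ceiling `−2e(P)` is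
  EMPTY: no radial positive-type `f` has `f 0 ≤ −2e(P)`, `f ≤ V_LJ` on `[n,∞) ∩ (0,∞)`, `f = V_LJ` on the
  pair distances of `P` beyond `n`, and the neutrality row.

Honest status of the stub (lead's reading, cycle 1): it is a template-free, all-range one-sided radial
Fourier NON-interpolation statement with inhomogeneous data `V_LJ` (the card's lever (D) localises it in
the far sign clause); by `exactAt_mono` nothing weaker in the range suffices, by `witness_eq` nothing weaker
in the template suffices, and no periodic minimiser is identified without item 0627/11961; the card's own
numerics put every accessible finite certificate two orders of magnitude below the ceiling
(`m_N ≈ 0.015` against `1.4352` at `ρ = 5/2`).  It is therefore crux-sized or larger; the line lives as a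
THEOREM path only for the sibling crux 13167 (`StrictCertificate`, template typed as `hcp(a,h)`).

STATE AT EXIT (cycle 1): infrastructure stub `stub_chargeBlowup` (the composition in closed form) LANDED as
`Theorems/ThreeConeCertificateExactCertificateChargeBlowup.lean` (p121919, commit 435bce9f4163: L1–L4 in tree
vocabulary + `exists_minimiser_tailSection_of_exactCertificate` + `not_exactCertificate_of_tailEmpty`);
open: `stub_tailEmpty` only; verdict LINE DEAD at `stub_tailEmpty` (`Lines/Ideator4Sketch-dead.md`).
-/

noncomputable section

namespace Summit.AtomisticToContinuum.Crystallization.Cruxes.ExactCertificate.ChargeBlowup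

open Literature.MathematicalPhysics.StatisticalMechanics
open Summit.AtomisticToContinuum.Crystallization.Theses.ThreeConeCertificate
open Summit.AtomisticToContinuum.Crystallization.Theorems.ExactCertificateNegative (IsSplit)
open Summit.AtomisticToContinuum.Crystallization.Theorems.ThreeConeCertificateExactCertificate.Slackness
  (summable_of_finRange f_eq_lennardJones_of_mem_points f_zero_add_two_mul_energyPerParticle_f summable_f_site
    periodicMinimum_of_witness)
open scoped BigOperators
open Filter Topology

/-- Ambient space. -/
abbrev E3 : Type := EuclideanSpace ℝ (Fin 3)

/-- Clause (S4) of the crux: `f` radially of positive type on `ℝ³` (finite Gram forms). -/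
def RadialPosType (f : ℝ → ℝ) : Prop :=
  ∀ (n : ℕ) (y : Fin n → E3) (w : Fin n → ℝ), 0 ≤ ∑ i, ∑ j, w i * w j * f (dist (y i) (y j))

/-- The tail distance set of the template: pair distances of `P` that are `≥ ρ`. -/
def tailDist (P : PeriodicConfiguration 3) (ρ : ℝ) : Set ℝ :=
  {r | ρ ≤ r ∧ ∃ a ∈ P.points, ∃ b ∈ P.points, a ≠ b ∧ r = dist a b}

/-- Core and tail truncations of a radial function at range `ρ`. -/
def coreOf (ρ : ℝ) (f : ℝ → ℝ) (r : ℝ) : ℝ := if r < ρ then f r else 0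
/-- see `coreOf` -/
def tailOf (ρ : ℝ) (f : ℝ → ℝ) (r : ℝ) : ℝ := if r < ρ then 0 else f r

/-- **THE TAIL SECTION** of template `P` at range `ρ`, charge ceiling `C`, touch set `T ⊆ tailDist P ρ`:
a radial positive-type `f` with `f 0 ≤ C`, `f ≤ V_LJ` on `[ρ,∞) ∩ (0,∞)`, `f = V_LJ` on `T`, and the
NEUTRALITY ROW written in its finite-linear form (inner `P`-sum of `f` + explicit `V_LJ`-tail sum of `P`):
`f 0 + 2 e_P(f·1_{(0,ρ)}) + 2 e_P(V_LJ·1_{[ρ,∞)}) = 0`.  `T = tailDist P ρ` is the full tail system;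
finite `T` are the finite sections solved numerically (kit job charge_blowup). -/
def TailSection (P : PeriodicConfiguration 3) (ρ C : ℝ) (T : Set ℝ) : Prop :=
  ∃ f : ℝ → ℝ, RadialPosType f ∧ f 0 ≤ C ∧
    (∀ r : ℝ, ρ ≤ r → 0 < r → f r ≤ lennardJones r) ∧
    (∀ r ∈ T, f r = lennardJones r) ∧
    f 0 + 2 * P.energyPerParticle (coreOf ρ f) + 2 * P.energyPerParticle (tailOf ρ lennardJones) = 0

/-- A witness of the crux WITH TEMPLATE `P` and some range `≤ ρ`. -/
def ExactWith (P : PeriodicConfiguration 3) (ρ : ℝ) : Prop :=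
  ∃ (ρ' c : ℝ) (g U f : ℝ → ℝ), ρ' ≤ ρ ∧ IsSplit ρ' c g U f ∧
    c + f 0 / 2 = -(P.energyPerParticle lennardJones)

/-- (L1, PROVED here from tree theorems `c_nonneg`, `f_le_tail`, `Slackness.f_eq_lennardJones_of_mem_points`,
`Slackness.f_zero_add_two_mul_energyPerParticle_f`, `energyPerParticle_split`; size S–M)
**NECESSITY WITH THE CHARGE CEILING**: a witness with template `P` and range `≤ ρ` puts its own `f` in the
full tail section with ceiling `C = −2 e(P)` — no `e*`, no stability constant. -/
theorem coreOf_of_le' (ρ : ℝ) (f : ℝ → ℝ) : ∀ r, ρ ≤ r → coreOf ρ f r = 0 :=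
  fun r hr => by simp [coreOf, not_lt.2 hr]

theorem tailSection_of_exactWith (P : PeriodicConfiguration 3) (ρ : ℝ) (h : ExactWith P ρ) :
    TailSection P ρ (-(2 * P.energyPerParticle lennardJones)) (tailDist P ρ) := by
  classical
  obtain ⟨ρ', c, g, U, f, hρ', hs, hv⟩ := h
  have hc := hs.c_nonneg
  -- touches on the tail distances of `P` (complementary slackness, tree)
  have htouch : ∀ r ∈ tailDist P ρ, f r = lennardJones r := by
    rintro r ⟨hρr, a, ha, b, hb, hab, rfl⟩
    exact f_eq_lennardJones_of_mem_points hs hv.le ha hb hab (hρ'.trans hρr)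
  -- the tail part of the `f`-energy equals the explicit `V_LJ`-tail energy (termwise)
  have htail : P.energyPerParticle (tailOf ρ f) = P.energyPerParticle (tailOf ρ lennardJones) := by
    unfold PeriodicConfiguration.energyPerParticle
    congr 1
    refine Finset.sum_congr rfl fun x hx => tsum_congr fun q => ?_
    simp only [tailOf]
    split_ifs with hlt
    · rfl
    · exact f_eq_lennardJones_of_mem_points hs hv.le (P.mem_points_of_mem_motif hx) q.2.1
        (fun heq => q.2.2 heq.symm) (hρ'.trans (not_lt.1 hlt))
  -- the `f`-energy splits into core + tail (core has finite range, `f`-sites are summable)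
  have hsplit : P.energyPerParticle f =
      P.energyPerParticle (coreOf ρ f) + P.energyPerParticle (tailOf ρ f) := by
    unfold PeriodicConfiguration.energyPerParticle
    rw [← mul_add, ← Finset.sum_add_distrib]
    congr 1
    refine Finset.sum_congr rfl fun x hx => ?_
    have hsum_f := summable_f_site hs hv.le (P.mem_points_of_mem_motif hx)
    have hsum_core : Summable fun q : {q : E3 // q ∈ P.points ∧ q ≠ x} =>
        coreOf ρ f (dist x q.1) := summable_of_finRange P (coreOf_of_le' ρ f) x
    have hsum_tail : Summable fun q : {q : E3 // q ∈ P.points ∧ q ≠ x} =>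
        tailOf ρ f (dist x q.1) := by
      refine (hsum_f.sub hsum_core).congr fun q => ?_
      simp only [coreOf, tailOf]
      split_ifs <;> ring
    rw [← hsum_core.tsum_add hsum_tail]
    exact tsum_congr fun q => by simp only [coreOf, tailOf]; split_ifs <;> ring
  have hneu := f_zero_add_two_mul_energyPerParticle_f hs hv.le
  refine ⟨f, fun n y w => hs.posType n y w, ?_, fun r hρr hr => hs.f_le_tail (hρ'.trans hρr) hr,
    htouch, ?_⟩
  · show f 0 ≤ -(2 * P.energyPerParticle lennardJones)
    linarith
  · rw [hsplit, htail] at hneu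
    linarith

/-- two-point quadratic form (local copy of the closure file's private lemma). [folklore] -/
private theorem quadForm_pair' (f : ℝ → ℝ) (a b : E3) (s : ℝ) :
    ∑ i : Fin 2, ∑ j : Fin 2, (![1, s] i) * (![1, s] j) * f (dist ((![a, b]) i) ((![a, b]) j))
      = (1 + s ^ 2) * f 0 + 2 * s * f (dist a b) := by
  simp only [Fin.sum_univ_two, Matrix.cons_val_zero, Matrix.cons_val_one, dist_self,
    dist_comm b a]
  ring

private theorem dist_zero_single' (r : ℝ) :
    dist (0 : E3) (EuclideanSpace.single 0 r) = |r| := by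
  rw [dist_comm, dist_zero_right, PiLp.norm_single, Real.norm_eq_abs]

/-- `|f r| ≤ f 0` for `r ≥ 0`, and `0 ≤ f 0`, for a radial positive-type `f`. [folklore] -/
theorem RadialPosType.abs_le {f : ℝ → ℝ} (h : RadialPosType f) {r : ℝ} (hr : 0 ≤ r) :
    |f r| ≤ f 0 := by
  have hp := h 2 ![0, EuclideanSpace.single 0 r] ![1, 1]
  have hm := h 2 ![0, EuclideanSpace.single 0 r] ![1, -1]
  rw [quadForm_pair', dist_zero_single', abs_of_nonneg hr] at hp hm
  norm_num at hp hm
  rw [_root_.abs_le]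
  constructor <;> linarith

theorem RadialPosType.nonneg {f : ℝ → ℝ} (h : RadialPosType f) : 0 ≤ f 0 := by
  simpa using h 1 (fun _ => 0) fun _ => 1

/-- Along an ultrafilter on `ℕ`, a bounded real sequence converges to its `limUnder`. [folklore] -/
private theorem tendsto_limUnder_of_abs_le' (𝒰 : Ultrafilter ℕ) {u : ℕ → ℝ} {B : ℝ}
    (h : ∀ k, |u k| ≤ B) :
    Filter.Tendsto u (𝒰 : Filter ℕ) (nhds (limUnder (𝒰 : Filter ℕ) u)) := by
  obtain ⟨x, -, hx⟩ := (isCompact_Icc (a := -B) (b := B)).ultrafilter_le_nhds' (𝒰.map u)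
    (Ultrafilter.mem_map.2 (Filter.univ_mem' fun k => abs_le.1 (h k)))
  rw [Ultrafilter.coe_map] at hx
  exact tendsto_nhds_limUnder ⟨x, hx⟩

/-- `coreOf ρ f` has finite range `ρ`. -/
theorem coreOf_of_le (ρ : ℝ) (f : ℝ → ℝ) {r : ℝ} (hr : ρ ≤ r) : coreOf ρ f r = 0 := by
  simp [coreOf, not_lt.2 hr]

/-- The finite-range energy per particle is a FINITE sum over a fixed finite set of neighbours
(independent of `f`): continuity in `f` for pointwise convergence follows. [folklore] -/
theorem tendsto_energyPerParticle_coreOf (P : PeriodicConfiguration 3) (ρ : ℝ) {l : Filter ℕ}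
    (f : ℕ → ℝ → ℝ) (g : ℝ → ℝ)
    (hf : ∀ r : ℝ, 0 ≤ r → r < ρ → Filter.Tendsto (fun N => f N r) l (nhds (g r))) :
    Filter.Tendsto (fun N => P.energyPerParticle (coreOf ρ (f N))) l
      (nhds (P.energyPerParticle (coreOf ρ g))) := by
  classical
  unfold PeriodicConfiguration.energyPerParticle
  refine Filter.Tendsto.const_mul _ (tendsto_finsetSum _ fun x _ => ?_)
  -- the neighbours of `x` within `ρ`: a finite set independent of the potential
  have hfin : {q : {q : E3 // q ∈ P.points ∧ q ≠ x} | dist x q.1 < ρ}.Finite := by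
    have h1 := P.finite_inter_points (Metric.isBounded_ball (x := x) (r := ρ))
    refine (h1.preimage Subtype.val_injective.injOn).subset ?_
    intro q hq
    exact ⟨by rw [Metric.mem_ball, dist_comm]; exact hq, q.2.1⟩
  have hzero : ∀ (φ : ℝ → ℝ) (q : {q : E3 // q ∈ P.points ∧ q ≠ x}), q ∉ hfin.toFinset →
      coreOf ρ φ (dist x q.1) = 0 := fun φ q hq => by
    apply coreOf_of_le
    by_contra hlt
    exact hq (hfin.mem_toFinset.2 (not_le.1 hlt))
  have hrw : ∀ φ : ℝ → ℝ, (∑' q : {q : E3 // q ∈ P.points ∧ q ≠ x}, coreOf ρ φ (dist x q.1))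
      = ∑ q ∈ hfin.toFinset, coreOf ρ φ (dist x q.1) := fun φ => tsum_eq_sum (hzero φ)
  simp only [hrw]
  refine tendsto_finsetSum _ fun q _ => ?_
  by_cases hq : dist x q.1 < ρ
  · simp only [coreOf, hq, if_true]
    exact hf _ dist_nonneg hq
  · simp only [coreOf, hq, if_false]
    exact tendsto_const_nhds

/-- (L2, PROVED here, size M; mechanism = pointwise limit along a non-principal ultrafilter, exactly as in
the landed closure lemma `ThreeConeCertificateExactCertificateClosure.stub_closure`: every clause of
`TailSection` is a closed finite-linear condition on point values, and `|f r| ≤ f 0 ≤ C` bounds them)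
**COMPLETENESS OF FINITE SECTIONS**: if every finite section along an exhausting chain of touch sets is
feasible with the SAME ceiling `C`, the full tail system is feasible with ceiling `C`.  Contrapositive =
CHARGE BLOW-UP: full tail system infeasible ⇒ the minimal charge of finite sections tends to `+∞`. -/
theorem tailSection_complete (P : PeriodicConfiguration 3) (ρ C : ℝ) (T : ℕ → Finset ℝ)
    (_hT : ∀ N, (↑(T N) : Set ℝ) ⊆ tailDist P ρ) (hcov : ∀ r ∈ tailDist P ρ, ∃ N₀, ∀ N, N₀ ≤ N → r ∈ T N)
    (h : ∀ N, TailSection P ρ C ↑(T N)) :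
    TailSection P ρ C (tailDist P ρ) := by
  classical
  choose f hpd hC hle heq hneu using h
  -- uniform bound `|f N r| ≤ |C|` at every `r ≥ 0`
  have hB : ∀ N (r : ℝ), 0 ≤ r → |f N r| ≤ |C| := fun N r hr =>
    ((hpd N).abs_le hr).trans ((hC N).trans (le_abs_self C))
  -- a non-principal ultrafilter and the pointwise ultralimit
  obtain ⟨𝒰, h𝒰⟩ : ∃ 𝒰 : Ultrafilter ℕ, (𝒰 : Filter ℕ) ≤ Filter.atTop :=
    ⟨Filter.hyperfilter ℕ, Filter.hyperfilter_le_cofinite.trans Nat.cofinite_eq_atTop.le⟩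
  set F : ℝ → ℝ := fun r => limUnder (𝒰 : Filter ℕ) fun N => f N r with hFdef
  have hF : ∀ r : ℝ, 0 ≤ r → Filter.Tendsto (fun N => f N r) (𝒰 : Filter ℕ) (nhds (F r)) :=
    fun r hr => tendsto_limUnder_of_abs_le' 𝒰 fun N => hB N r hr
  refine ⟨F, fun n y w => ?_, ?_, fun r hρ hr => ?_, fun r hr => ?_, ?_⟩
  · -- positive type passes to the limit
    have hTd : Filter.Tendsto (fun N => ∑ i, ∑ j, w i * w j * f N (dist (y i) (y j))) (𝒰 : Filter ℕ)
        (nhds (∑ i, ∑ j, w i * w j * F (dist (y i) (y j)))) :=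
      tendsto_finsetSum _ fun i _ => tendsto_finsetSum _ fun j _ =>
        (hF (dist (y i) (y j)) dist_nonneg).const_mul (w i * w j)
    exact ge_of_tendsto' hTd fun N => hpd N n y w
  · -- the ceiling
    exact le_of_tendsto' (hF 0 le_rfl) fun N => hC N
  · -- the sign clause on `[ρ,∞) ∩ (0,∞)`
    exact le_of_tendsto' (hF r hr.le) fun N => hle N r hρ hr
  · -- touches: eventually `f N r = V_LJ r`
    obtain ⟨N₀, hN₀⟩ := hcov r hr
    have hr0 : 0 ≤ r := by obtain ⟨-, a, -, b, -, -, rfl⟩ := hr; exact dist_nonneg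
    have hge : ∀ᶠ N in (𝒰 : Filter ℕ), N₀ ≤ N := h𝒰 (Filter.eventually_ge_atTop N₀)
    have hev : ∀ᶠ N in (𝒰 : Filter ℕ), f N r = lennardJones r :=
      hge.mono fun N hN => heq N r (by exact_mod_cast hN₀ N hN)
    exact tendsto_nhds_unique (hF r hr0) (tendsto_const_nhds.congr' (hev.mono fun N hN => hN.symm))
  · -- neutrality (finite-linear): pass the limit through the finite-range energy
    have hE := tendsto_energyPerParticle_coreOf P ρ f F fun r hr _ => hF r hr
    have hsum : Filter.Tendsto (fun N => f N 0 + 2 * P.energyPerParticle (coreOf ρ (f N))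
        + 2 * P.energyPerParticle (tailOf ρ lennardJones)) (𝒰 : Filter ℕ)
        (nhds (F 0 + 2 * P.energyPerParticle (coreOf ρ F) + 2 * P.energyPerParticle (tailOf ρ lennardJones))) :=
      ((hF 0 le_rfl).add (hE.const_mul 2)).add tendsto_const_nhds
    exact tendsto_nhds_unique hsum (tendsto_const_nhds.congr fun N => (hneu N).symm)

/-- (L3, two lines from L1 + monotonicity of `TailSection` in `T`) **THE FINITE KILL SCHEMA**: an EMPTY
finite section with the template's own ceiling refutes every witness with that template at every range
`≤ ρ`. -/
theorem tailSection_mono (P : PeriodicConfiguration 3) (ρ C : ℝ) {T T' : Set ℝ} (hTT' : T ⊆ T')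
    (h : TailSection P ρ C T') : TailSection P ρ C T := by
  obtain ⟨f, hpd, hC, hle, heq, hneu⟩ := h
  exact ⟨f, hpd, hC, hle, fun r hr => heq r (hTT' hr), hneu⟩

theorem not_exactWith_of_section_empty (P : PeriodicConfiguration 3) (ρ : ℝ) (T : Set ℝ)
    (hT : T ⊆ tailDist P ρ) (h : ¬ TailSection P ρ (-(2 * P.energyPerParticle lennardJones)) T) :
    ¬ ExactWith P ρ :=
  fun hE => h (tailSection_mono P ρ _ hT (tailSection_of_exactWith P ρ hE))

/-- **Schoenberg transfer** (the one Literature fact the certificate needs; Schoenberg 1938, Ann. Math. 39,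
radial positive-definite functions on `ℝ³` are `a·1_{0} + ∫ sinc(t r) dμ(t)`, `μ ≥ 0` finite — modulo the
automatic continuity of radial positive-type functions off the origin in `d ≥ 2`): a finite kernel
inequality `η + Σ_j κ_j sinc(t s_j) ≤ 1` valid for ALL `t ≥ 0`, with `η ≤ 1` (the nugget), transfers to
every radial positive-type `f` as `η f 0 + Σ_j κ_j f(s_j) ≤ f 0`.  Filed as a hypothesis, never an axiom. -/
def SchoenbergTransfer : Prop :=
  ∀ (ι : Type) [Fintype ι] (s κ : ι → ℝ) (η : ℝ), (∀ j, 0 < s j) → η ≤ 1 →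
    (∀ t : ℝ, 0 ≤ t → η + ∑ j, κ j * Real.sinc (t * s j) ≤ 1) →
    ∀ f : ℝ → ℝ, RadialPosType f → η * f 0 + ∑ j, κ j * f (s j) ≤ f 0

/-- (L4, provable now given `SchoenbergTransfer`, size S) **A DUAL CERTIFICATE EMPTIES A SECTION.**
Data: touch radii `s j ∈ T` with free multipliers `lam j`, sign radii `u i ≥ ρ` with multipliers `σ i ≤ 0`,
the neutrality multiplier `η`, the inner shells of `P` below `ρ` entering the neutrality row through the
finite-range energy `e_P(f·1_{(0,ρ)})` (written here abstractly as a finite list of inner radii `q k` with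
per-particle multiplicities `μ k`, see `hinner`), and the explicit constant `τ = −2 e_P(V_LJ·1_{[ρ,∞)})`.
If the dual function is `≤ 1` on `[0,∞)` and the dual value exceeds the ceiling `C`, the section is empty. -/
theorem section_empty_of_dual (hS : SchoenbergTransfer) (P : PeriodicConfiguration 3) (ρ C : ℝ)
    {m n p : ℕ} (s lam : Fin m → ℝ) (u σ : Fin n → ℝ) (q μ : Fin p → ℝ) (η τ : ℝ)
    (T : Set ℝ) (hs : ∀ j, s j ∈ T) (hT : T ⊆ tailDist P ρ) (hu : ∀ i, ρ ≤ u i) (hρ : 0 < ρ)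
    (hσ : ∀ i, σ i ≤ 0) (hη : η ≤ 1) (hq : ∀ k, 0 < q k)
    (hinner : ∀ f : ℝ → ℝ, 2 * P.energyPerParticle (coreOf ρ f) = ∑ k, μ k * f (q k))
    (hτ : τ = -(2 * P.energyPerParticle (tailOf ρ lennardJones)))
    (hΦ : ∀ t : ℝ, 0 ≤ t →
      η * (1 + ∑ k, μ k * Real.sinc (t * q k)) + ∑ j, lam j * Real.sinc (t * s j)
        + ∑ i, σ i * Real.sinc (t * u i) ≤ 1)
    (hval : C < η * τ + ∑ j, lam j * lennardJones (s j) + ∑ i, σ i * lennardJones (u i)) :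
    ¬ TailSection P ρ C T := by
  rintro ⟨f, hpd, hC, hle, heq, hneu⟩
  -- index the three families of radii by a sum type and apply the transfer once
  let ι := (Fin p ⊕ Fin m) ⊕ Fin n
  let S : ι → ℝ := fun x => match x with
    | Sum.inl (Sum.inl k) => q k
    | Sum.inl (Sum.inr j) => s j
    | Sum.inr i => u i
  let K : ι → ℝ := fun x => match x with
    | Sum.inl (Sum.inl k) => η * μ k
    | Sum.inl (Sum.inr j) => lam j
    | Sum.inr i => σ i
  have hSpos : ∀ x, 0 < S x := by
    rintro ((k | j) | i)
    · exact hq k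
    · exact lt_of_lt_of_le hρ (hT (hs j)).1
    · exact lt_of_lt_of_le hρ (hu i)
  have hker : ∀ t : ℝ, 0 ≤ t → η + ∑ x, K x * Real.sinc (t * S x) ≤ 1 := by
    intro t ht
    have := hΦ t ht
    simp only [ι, K, S, Fintype.sum_sum_type] at this ⊢
    have e1 : ∑ k, η * μ k * Real.sinc (t * q k) = η * ∑ k, μ k * Real.sinc (t * q k) := by
      rw [Finset.mul_sum]; refine Finset.sum_congr rfl fun k _ => by ring
    linarith [e1]
  have key := hS ι S K η hSpos hη hker f hpd
  simp only [ι, K, S, Fintype.sum_sum_type] at key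
  have e1 : ∑ k, η * μ k * f (q k) = η * ∑ k, μ k * f (q k) := by
    rw [Finset.mul_sum]; refine Finset.sum_congr rfl fun k _ => by ring
  rw [e1] at key
  -- neutrality in finite form: f 0 + Σ μ_k f(q_k) = τ
  have hN : f 0 + ∑ k, μ k * f (q k) = τ := by rw [← hinner f, hτ]; linarith
  -- touches and signs
  have hT' : ∑ j, lam j * f (s j) = ∑ j, lam j * lennardJones (s j) :=
    Finset.sum_congr rfl fun j _ => by rw [heq _ (hs j)]
  have hU : ∑ i, σ i * lennardJones (u i) ≤ ∑ i, σ i * f (u i) :=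
    Finset.sum_le_sum fun i _ =>
      mul_le_mul_of_nonpos_left (hle (u i) (hu i) (lt_of_lt_of_le hρ (hu i))) (hσ i)
  have : η * τ + ∑ j, lam j * lennardJones (s j) + ∑ i, σ i * lennardJones (u i) ≤ f 0 := by
    have h1 : η * f 0 + η * ∑ k, μ k * f (q k) = η * τ := by rw [← hN]; ring
    linarith
  linarith

/-- (glue, two lines) how a template kill feeds the crux: the crux with its template restricted to a class
`Pcl` of periodic configurations dies as soon as every `P ∈ Pcl` has an empty finite section at some range
`ρ_P` beyond which… — NO: ranges are an up-set (`exactAt_mono`), so a kill at `ρ` covers ranges `≤ ρ`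
only; the template-restricted crux dies iff sections are empty along `ρ → ∞`.  Recorded to keep the
quantifiers honest: -/
theorem not_exact_restricted (Pcl : Set (PeriodicConfiguration 3))
    (h : ∀ P ∈ Pcl, ∀ n : ℕ, ¬ ExactWith P n) :
    ¬ ∃ (P : PeriodicConfiguration 3) (ρ c : ℝ) (g U f : ℝ → ℝ), P ∈ Pcl ∧ IsSplit ρ c g U f ∧
        c + f 0 / 2 = -(P.energyPerParticle lennardJones) := by
  rintro ⟨P, ρ, c, g, U, f, hP, hs, hv⟩
  obtain ⟨n, hn⟩ := exists_nat_ge ρ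
  exact h P hP n ⟨ρ, c, g, U, f, hn, hs, hv⟩

/-! ## The line, owned (lead a2): composition to the crux in the NEGATIVE direction

The lane composes to `ExactCertificate` (stmt-AtomisticToContinuum-11959) only through its negation.
Reduction (proved): a crux witness `(P, ρ, c, g, U, f)` makes `P` a PERIODIC MINIMISER of the
Lennard-Jones energy per particle (tree `Slackness.periodicMinimum_of_witness`: `e(P) = e*`), and is a
witness at every range `≥ ρ` (`IsSplit.mono`), in particular at every integer range `n ≥ ⌈ρ⌉₊`; by L1 its
`f` lies in the full tail section of `P` at range `n` with ceiling `−2e(P)`.  So the crux is refuted by the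
single stub below — tail sections of periodic minimisers are empty at every integer range — and by nothing
weaker that this lane can state: ranges are an up-set (`exactAt_mono`), and the template is pinned only to
"some periodic minimiser", which no theorem in the tree identifies (item 0627/11961). -/

/-- `ExactWith P ·` is an up-set in the range (witnesses persist when the range grows). [folklore] -/
theorem exactWith_mono {P : PeriodicConfiguration 3} {ρ ρ' : ℝ} (hρ : ρ ≤ ρ') (h : ExactWith P ρ) :
    ExactWith P ρ' := by
  obtain ⟨ρ₀, c, g, U, f, h₀, hs, hv⟩ := h
  exact ⟨ρ₀, c, g, U, f, h₀.trans hρ, hs, hv⟩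

/-- **What the crux hands this lane** (proved): a template `P` that is a periodic minimiser of the
Lennard-Jones energy per particle, with a witness of the crux at every integer range beyond some `n₀`.
[folklore] -/
theorem exists_minimiser_exactWith_of_exactCertificate (h : ExactCertificate) :
    ∃ P : PeriodicConfiguration 3,
      (∀ Q : PeriodicConfiguration 3, P.energyPerParticle lennardJones ≤ Q.energyPerParticle lennardJones) ∧
      ∃ n₀ : ℕ, ∀ n : ℕ, n₀ ≤ n → ExactWith P n := by
  obtain ⟨P, ρ, c, g, U, f, h1, h2, h3, h4, h5, h6⟩ := h
  have hs : IsSplit ρ c g U f := ⟨h1, h2, h3, h4, h5⟩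
  refine ⟨P, periodicMinimum_of_witness hs h6.le, ⌈ρ⌉₊, fun n hn => ?_⟩
  have hρn : ρ ≤ (n : ℝ) := (Nat.le_ceil ρ).trans (by exact_mod_cast hn)
  exact ⟨ρ, c, g, U, f, hρn, hs, h6⟩

/-- **STUB `stub_tailEmpty` — the line's one load-bearing claim** (registered; every notion unfolded to
tree vocabulary: `TailSection P n (−2e(P)) (tailDist P n)` written out).  For every periodic minimiser `P`
of the Lennard-Jones energy per particle and every integer range `n`, NO radial positive-type `f` on `ℝ³`
has charge `f 0 ≤ −2e(P)`, lies below `V_LJ` on `[n,∞) ∩ (0,∞)`, touches `V_LJ` at every pair distance of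
`P` beyond `n`, and satisfies the neutrality row
`f 0 + 2e_P(f·1_{(0,n)}) + 2e_P(V_LJ·1_{[n,∞)}) = 0`.
Template-free, all-range one-sided radial Fourier non-interpolation with inhomogeneous data; open. -/
theorem stub_tailEmpty : ∀ (P : PeriodicConfiguration 3) (n : ℕ),
    (∀ Q : PeriodicConfiguration 3, P.energyPerParticle lennardJones ≤ Q.energyPerParticle lennardJones) →
    ¬ ∃ f : ℝ → ℝ,
      (∀ (m : ℕ) (y : Fin m → EuclideanSpace ℝ (Fin 3)) (w : Fin m → ℝ),
        0 ≤ ∑ i, ∑ j, w i * w j * f (dist (y i) (y j))) ∧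
      f 0 ≤ -(2 * P.energyPerParticle lennardJones) ∧
      (∀ r : ℝ, (n : ℝ) ≤ r → 0 < r → f r ≤ lennardJones r) ∧
      (∀ r : ℝ, (n : ℝ) ≤ r → (∃ a ∈ P.points, ∃ b ∈ P.points, a ≠ b ∧ r = dist a b) →
        f r = lennardJones r) ∧
      f 0 + 2 * P.energyPerParticle (fun r => if r < (n : ℝ) then f r else 0)
        + 2 * P.energyPerParticle (fun r => if r < (n : ℝ) then 0 else lennardJones r) = 0 := by
  sorry

/-- **COMPOSITION (sorry-free modulo `stub_tailEmpty`): the line refutes the crux.**  A crux witness gives a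
periodic minimiser `P` and a witness at the integer range `n₀` (`exists_minimiser_exactWith_of_exactCertificate`);
L1 (`tailSection_of_exactWith`) puts its `f` in the full tail section of `P` at range `n₀` with ceiling `−2e(P)`,
which `stub_tailEmpty` says is empty. [folklore] -/
theorem not_exactCertificate_of
    (hstub : ∀ (P : PeriodicConfiguration 3) (n : ℕ),
      (∀ Q : PeriodicConfiguration 3, P.energyPerParticle lennardJones ≤ Q.energyPerParticle lennardJones) →
      ¬ ∃ f : ℝ → ℝ,
        (∀ (m : ℕ) (y : Fin m → EuclideanSpace ℝ (Fin 3)) (w : Fin m → ℝ),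
          0 ≤ ∑ i, ∑ j, w i * w j * f (dist (y i) (y j))) ∧
        f 0 ≤ -(2 * P.energyPerParticle lennardJones) ∧
        (∀ r : ℝ, (n : ℝ) ≤ r → 0 < r → f r ≤ lennardJones r) ∧
        (∀ r : ℝ, (n : ℝ) ≤ r → (∃ a ∈ P.points, ∃ b ∈ P.points, a ≠ b ∧ r = dist a b) →
          f r = lennardJones r) ∧
        f 0 + 2 * P.energyPerParticle (fun r => if r < (n : ℝ) then f r else 0)
          + 2 * P.energyPerParticle (fun r => if r < (n : ℝ) then 0 else lennardJones r) = 0) :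
    ¬ ExactCertificate := by
  intro hE
  obtain ⟨P, hmin, n₀, hn₀⟩ := exists_minimiser_exactWith_of_exactCertificate hE
  obtain ⟨f, hpd, hC, hle, heq, hneu⟩ := tailSection_of_exactWith P n₀ (hn₀ n₀ le_rfl)
  exact hstub P n₀ hmin ⟨f, hpd, hC, hle, fun r hr hab => heq r ⟨hr, hab⟩, hneu⟩

/-- **Registered stub `stub_chargeBlowup`** (infrastructure stub, PROVED here and landed in
`Theorems/ThreeConeCertificateExactCertificateChargeBlowup.lean`): the line's composition in closed form. [folklore] -/
theorem stub_chargeBlowup :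
    (∀ (P : PeriodicConfiguration 3) (n : ℕ),
      (∀ Q : PeriodicConfiguration 3, P.energyPerParticle lennardJones ≤ Q.energyPerParticle lennardJones) →
      ¬ ∃ f : ℝ → ℝ,
        (∀ (m : ℕ) (y : Fin m → EuclideanSpace ℝ (Fin 3)) (w : Fin m → ℝ),
          0 ≤ ∑ i, ∑ j, w i * w j * f (dist (y i) (y j))) ∧
        f 0 ≤ -(2 * P.energyPerParticle lennardJones) ∧
        (∀ r : ℝ, (n : ℝ) ≤ r → 0 < r → f r ≤ lennardJones r) ∧
        (∀ r : ℝ, (n : ℝ) ≤ r → (∃ a ∈ P.points, ∃ b ∈ P.points, a ≠ b ∧ r = dist a b) →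
          f r = lennardJones r) ∧
        f 0 + 2 * P.energyPerParticle (fun r => if r < (n : ℝ) then f r else 0)
          + 2 * P.energyPerParticle (fun r => if r < (n : ℝ) then 0 else lennardJones r) = 0) →
    ¬ ExactCertificate :=
  not_exactCertificate_of

/-- The negation of the crux, named (this line's target: the lane composes to the crux only negatively). -/
def NotExactCertificate : Prop := ¬ ExactCertificate

/-- **SKELETON TARGET** — the same composition with the stub named: `¬ ExactCertificate` (by name) modulo
`stub_tailEmpty`. [folklore] -/
theorem NotExactCertificate_proof : NotExactCertificate :=
  not_exactCertificate_of stub_tailEmpty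

/-- Alias with the crux decl in the name (audit edge `refutes`). [folklore] -/
theorem ExactCertificate_false : ¬ ExactCertificate := NotExactCertificate_proof

end Summit.AtomisticToContinuum.Crystallization.Cruxes.ExactCertificate.ChargeBlowup

end
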